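import Summits.MatrixMultiplication.OmegaCensus.SmallFormats.KroneckerChains

/-!
# Kronecker modules II: a minimal chain splits off (the `L_ηᵀ` summand)

Cell `pub-omega` (unit `pub-omega-tensor-g33`), topic `Summits/MatrixMultiplication/OmegaCensus` (sub-folder `SmallFormats`).
Framing (verbatim): lottery ticket; floor = certified bounds/negative ranges. HONEST FRAMING: general linear algebra toward
PROVING `KroneckerBlockForm97`; nothing on `ω` here.

**Theorem (`peel`).** Let `a b : U →ₗ[k] V` and let `x` be a nonzero I-chain of MINIMAL length `η` (`MinimalAt a b η`).
Then `x 0, …, x η` are linearly independent, `b (x 0), …, b (x (η-1))` are linearly independent, and there are subspaces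
`U' ≤ U`, `V' ≤ V` invariant under `a` and `b` with `U = ⟨x 0,…,x η⟩ ⊕ U'`, `V = ⟨b x 0,…,b x (η-1)⟩ ⊕ V'` — i.e. the module
splits as `L_ηᵀ ⊕ (U', V')` (Gantmacher XII §3 Thm 4, row version, module language). Proof: independence by building shorter
chains from a dependence (minimality); the complement is cut out by a *dual cochain* `Ψ₀,…,Ψ_{η-1} ∈ V*` with
`Ψ_{s+1} ∘ b = Ψ_s ∘ a` and `Ψ_s (b x_t) = δ_{st}`, constructed inductively: `Ψ₀` exists because
`b x₀ ∉ ⟨b x₁,…⟩ + Z_{η-1}` (`Z_j` = heads `a p₀` of open paths of length `j`; again minimality), and each extension step is the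
annihilator identity `(Z.comap b)^⊥ = Z^⊥.map bᵀ` (`dualAnnihilator_comap_eq`).
-/

namespace Summit.MatrixMultiplication.OmegaCensus.SmallFormats.Kronecker

open Module Submodule

variable {k : Type*} [Field k] {U V : Type*} [AddCommGroup U] [Module k U] [AddCommGroup V] [Module k V]
variable {a b : U →ₗ[k] V}

/-! ## Independence of a minimal chain -/

section Independence

variable {η : ℕ} {x : ℕ → U}

/-- **The `b`-images of a minimal chain are linearly independent**: `b x₀, …, b x_{η-1}`. -/
theorem linearIndependent_b_chain (hx : IsChain a b η x) (hx0 : x ≠ 0) (hmin : MinimalAt a b η) :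
    LinearIndependent k (fun t : Fin η => b (x t)) := by
  classical
  rw [Fintype.linearIndependent_iff]
  intro c hc
  -- coefficients as a sequence
  let C : ℕ → k := fun s => if h : s < η then c ⟨s, h⟩ else 0
  have hC : ∀ t : Fin η, C t = c t := fun t => by simp [C, t.2]
  have hsum : ∑ s ∈ Finset.range η, C s • b (x s) = 0 := by
    rw [Finset.sum_range (fun s => C s • b (x s))]
    simpa [hC] using hc
  -- the combined chain y_j = Σ_s C_s x_{j+1+s} of length η - 1
  let y : ℕ → U := fun j => ∑ s ∈ Finset.range η, C s • x (j + 1 + s)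
  cases η with
  | zero => intro t; exact t.elim0
  | succ η' =>
    have hy : IsChain a b η' y := by
      refine ⟨?_, fun j => ?_, fun j hj => ?_⟩
      · simp only [y, map_sum, map_smul, Nat.zero_add]
        simp_rw [show ∀ s, 1 + s = s + 1 from fun s => by omega, hx.rel]
        exact hsum
      · simp only [y, map_sum, map_smul]
        simp_rw [show ∀ s, j + 1 + 1 + s = (j + 1 + s) + 1 from fun s => by omega, hx.rel]
      · simp only [y]
        exact Finset.sum_eq_zero (fun s _ => by rw [hx.supp _ (by omega), smul_zero])
    have hy0 : y = 0 := hmin η' (Nat.lt_succ_self _) y hy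
    have hxtop := hx.top_ne_zero hx0 hmin
    -- triangular solve: C s = 0 for all s ≤ η' by strong induction
    have hCs : ∀ s, s < η' + 1 → C s = 0 := by
      intro s
      induction s using Nat.strong_induction_on with
      | _ s ih =>
        intro hs
        have hys : y (η' - s) = 0 := by rw [hy0]; rfl
        have : y (η' - s) = C s • x (η' + 1) := by
          simp only [y]
          rw [Finset.sum_eq_single s]
          · congr 2; omega
          · intro s' hs' hne
            rcases Nat.lt_or_gt_of_ne hne with h | h
            · rw [ih s' h (by omega), zero_smul]
            · rw [hx.supp _ (by omega), smul_zero]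
          · intro hs'; exact absurd (Finset.mem_range.mpr hs) hs'
        rw [this] at hys
        exact (smul_eq_zero.mp hys).resolve_right hxtop
    intro t
    rw [← hC t]
    exact hCs t t.2

/-- **A minimal chain is linearly independent**: `x₀, …, x_η`. -/
theorem linearIndependent_chain (hx : IsChain a b η x) (hx0 : x ≠ 0) (hmin : MinimalAt a b η) :
    LinearIndependent k (fun t : Fin (η + 1) => x t) := by
  classical
  rw [Fintype.linearIndependent_iff]
  intro d hd
  have hb : ∑ t : Fin (η + 1), d t • b (x t) = 0 := by
    have := congrArg b hd
    simpa using this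
  rw [Fin.sum_univ_castSucc] at hb hd
  simp only [Fin.val_castSucc, Fin.val_last, hx.b_last, smul_zero, add_zero] at hb
  have hw := linearIndependent_b_chain hx hx0 hmin
  rw [Fintype.linearIndependent_iff] at hw
  have hd' : ∀ t : Fin η, d (Fin.castSucc t) = 0 := hw _ hb
  simp only [hd', zero_smul, Finset.sum_const_zero, zero_add, Fin.val_last] at hd
  have hlast : d (Fin.last η) = 0 := (smul_eq_zero.mp hd).resolve_right (hx.top_ne_zero hx0 hmin)
  intro t
  rcases Fin.eq_castSucc_or_eq_last t with ⟨t', rfl⟩ | rfl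
  · exact hd' t'
  · exact hlast

end Independence

/-! ## Heads of open paths -/

variable (a b) in
/-- `Z j` = the subspace of heads `a (p 0)` of open paths `p` of length `j`. -/
def Z (j : ℕ) : Submodule k V where
  carrier := {v | ∃ p, IsOpenPath a b j p ∧ a (p 0) = v}
  zero_mem' := ⟨0, IsOpenPath.zero j, by simp⟩
  add_mem' := by
    rintro _ _ ⟨p, hp, rfl⟩ ⟨q, hq, rfl⟩
    exact ⟨p + q, hp.add hq, by simp⟩
  smul_mem' := by
    rintro c _ ⟨p, hp, rfl⟩
    exact ⟨c • p, hp.smul c, by simp⟩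

/-- Membership in `Z j`. -/
theorem mem_Z {j : ℕ} {v : V} : v ∈ Z a b j ↔ ∃ p, IsOpenPath a b j p ∧ a (p 0) = v := Iff.rfl

/-- `Z` is monotone in the length. -/
theorem Z_mono {i j : ℕ} (hij : i ≤ j) : Z a b i ≤ Z a b j := by
  rintro v ⟨p, hp, rfl⟩
  exact ⟨p, hp.mono hij, rfl⟩

/-- If `b u` is the head of an open path of length `j` then `a u` is the head of an open path of length `j + 1`. -/
theorem a_mem_Z_succ {j : ℕ} {u : U} (hu : b u ∈ Z a b j) : a u ∈ Z a b (j + 1) := by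
  obtain ⟨p, hp, hpu⟩ := hu
  exact ⟨prepend u p, hp.prepend u hpu, by simp⟩

/-- `a (ker b) ⊆ Z j` for `j ≥ 1`. -/
theorem a_mem_Z_of_b_eq_zero {j : ℕ} (hj : 1 ≤ j) {u : U} (hu : b u = 0) : a u ∈ Z a b j :=
  Z_mono hj ⟨prepend u 0, IsOpenPath.single hu, by simp⟩

/-! ## The annihilator of a preimage -/

/-- **Annihilator of a preimage**: `(S.comap f)^⊥ = S^⊥.map fᵀ` (vector spaces). -/
theorem dualAnnihilator_comap_eq (f : U →ₗ[k] V) (S : Submodule k V) :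
    (S.comap f).dualAnnihilator = S.dualAnnihilator.map f.dualMap := by
  have h1 : S.comap f = LinearMap.ker (S.mkQ ∘ₗ f) := by
    rw [LinearMap.ker_comp, Submodule.ker_mkQ]
  rw [h1, ← LinearMap.range_dualMap_eq_dualAnnihilator_ker, ← LinearMap.dualMap_comp_dualMap, LinearMap.range_comp,
    Submodule.range_dualMap_mkQ_eq]

/-- Extension step of the dual cochain: if `ψ` kills `Z (j+1)` then some `ψ'` with `ψ' ∘ b = ψ ∘ a` kills `Z j`. -/
theorem exists_dual_step {j : ℕ} (ψ : Dual k V) (hψ : Z a b (j + 1) ≤ LinearMap.ker ψ) :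
    ∃ ψ' : Dual k V, ψ' ∘ₗ b = ψ ∘ₗ a ∧ Z a b j ≤ LinearMap.ker ψ' := by
  have hmem : ψ ∘ₗ a ∈ ((Z a b j).comap b).dualAnnihilator := by
    rw [Submodule.mem_dualAnnihilator]
    intro u hu
    exact hψ (a_mem_Z_succ hu)
  rw [dualAnnihilator_comap_eq] at hmem
  obtain ⟨ψ', hψ', h⟩ := hmem
  refine ⟨ψ', h, fun v hv => ?_⟩
  exact (Submodule.mem_dualAnnihilator ψ').mp hψ' v hv

/-! ## The splitting -/

section Peel

variable {η' : ℕ} {x : ℕ → U}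

/-- Key separation (minimality): for a minimal nonzero chain of length `η' + 1`,
`b x₀ ∉ ⟨b x₁, …, b x_{η'}⟩ + Z_{η'}`. -/
theorem b_head_notMem (hx : IsChain a b (η' + 1) x) (hx0 : x ≠ 0) (hmin : MinimalAt a b (η' + 1)) :
    b (x 0) ∉ span k (Set.range fun t : Fin η' => b (x (t + 1))) ⊔ Z a b η' := by
  classical
  intro hmem
  obtain ⟨y₁, hy₁, z, hz, hsum⟩ := Submodule.mem_sup.mp hmem
  obtain ⟨c, rfl⟩ := (Submodule.mem_span_range_iff_exists_fun k).mp hy₁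
  obtain ⟨p, hp, rfl⟩ := hz
  -- coefficient sequence: C (t+1) = c t for t < η', else 0
  let C : ℕ → k := fun t => if h : 1 ≤ t ∧ t < η' + 1 then c ⟨t - 1, by omega⟩ else 0
  have hC0 : C 0 = 0 := by simp [C]
  have hCs : ∀ t : Fin η', C (t + 1) = c t := fun t => by
    simp [C, t.2]
  let y : ℕ → U := prepend (x 0) (fun j => p j + ∑ t ∈ Finset.range (η' + 1), C t • x (t + j + 1))
  have hy : IsChain a b η' y := by
    refine ⟨by simpa [y] using hx.head, fun j => ?_, fun j hj => ?_⟩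
    · cases j with
      | zero =>
        simp only [y, prepend_succ, prepend_zero, map_add, map_sum, map_smul, Nat.add_zero]
        simp_rw [hx.rel]
        rw [Finset.sum_range_succ', hC0, zero_smul, add_zero, ← hsum, add_comm]
        congr 1
        rw [Finset.sum_range (fun t => C (t + 1) • b (x (t + 1)))]
        exact Finset.sum_congr rfl (fun t _ => by rw [hCs])
      | succ j =>
        simp only [y, prepend_succ, map_add, map_sum, map_smul]
        rw [hp.rel j]
        simp_rw [show ∀ t, t + (j + 1) + 1 = (t + j + 1) + 1 from fun t => by omega, hx.rel]
    · cases j with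
      | zero => exact absurd hj (Nat.not_lt_zero _)
      | succ j =>
        simp only [y, prepend_succ]
        rw [hp.supp j (by omega), zero_add]
        refine Finset.sum_eq_zero (fun t _ => ?_)
        by_cases h : 1 ≤ t ∧ t < η' + 1
        · rw [hx.supp _ (by omega), smul_zero]
        · have hCt : C t = 0 := by simp only [C, dif_neg h]
          rw [hCt, zero_smul]
  have hy0 : y = 0 := hmin η' (Nat.lt_succ_self _) y hy
  have : y 0 = x 0 := by simp [y]
  exact hx.bot_ne_zero hx0 hmin (by rw [← this, hy0]; rfl)

/-- The dual cochain: `Ψ 0, …, Ψ η'` with `Ψ (s+1) ∘ b = Ψ s ∘ a`, `Ψ 0 (b x₀) = 1`, `Ψ 0` kills `b x_{t+1}`, and `Ψ s`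
kills `Z (η' - s)`. -/
theorem exists_cochain (hx : IsChain a b (η' + 1) x) (hx0 : x ≠ 0) (hmin : MinimalAt a b (η' + 1)) :
    ∃ Ψ : ℕ → Dual k V, Ψ 0 (b (x 0)) = 1 ∧ (∀ t : Fin η', Ψ 0 (b (x (t + 1))) = 0) ∧
      (∀ r < η', Ψ (r + 1) ∘ₗ b = Ψ r ∘ₗ a) ∧ ∀ s ≤ η', Z a b (η' - s) ≤ LinearMap.ker (Ψ s) := by
  classical
  -- Ψ 0 by separation
  set S := span k (Set.range fun t : Fin η' => b (x (t + 1))) ⊔ Z a b η' with hS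
  obtain ⟨f, hf, hfS⟩ := Submodule.exists_dual_map_eq_bot_of_notMem (b_head_notMem hx hx0 hmin) inferInstance
  have hfS' : S ≤ LinearMap.ker f := LinearMap.le_ker_iff_map.mpr hfS
  let ψ₀ : Dual k V := (f (b (x 0)))⁻¹ • f
  have hψ₀S : S ≤ LinearMap.ker ψ₀ := fun v hv => by
    have := hfS' hv
    rw [LinearMap.mem_ker] at this ⊢
    simp [ψ₀, this]
  -- inductive construction
  have step : ∀ s ≤ η', ∃ Ψ : ℕ → Dual k V, Ψ 0 = ψ₀ ∧ (∀ r < s, Ψ (r + 1) ∘ₗ b = Ψ r ∘ₗ a) ∧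
      Z a b (η' - s) ≤ LinearMap.ker (Ψ s) ∧ ∀ r ≤ s, Z a b (η' - r) ≤ LinearMap.ker (Ψ r) := by
    intro s
    induction s with
    | zero =>
      intro _
      refine ⟨fun _ => ψ₀, rfl, fun r hr => absurd hr (Nat.not_lt_zero _), ?_, fun r hr => ?_⟩
      · exact le_trans (by rw [Nat.sub_zero]; exact le_sup_right) hψ₀S
      · obtain rfl : r = 0 := by omega
        exact le_trans (by rw [Nat.sub_zero]; exact le_sup_right) hψ₀S
    | succ s ih =>
      intro hs
      obtain ⟨Ψ, hΨ0, hrel, hker, hall⟩ := ih (by omega)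
      have hker' : Z a b (η' - (s + 1) + 1) ≤ LinearMap.ker (Ψ s) := by
        rw [show η' - (s + 1) + 1 = η' - s by omega]; exact hker
      obtain ⟨ψ', hψ'rel, hψ'ker⟩ := exists_dual_step (Ψ s) hker'
      refine ⟨fun r => if r ≤ s then Ψ r else ψ', by simp [hΨ0], fun r hr => ?_, by simp [hψ'ker], fun r hr => ?_⟩
      · rcases Nat.lt_succ_iff_lt_or_eq.mp hr with h | rfl
        · simp only [show r + 1 ≤ s from h, show r ≤ s by omega, if_true]; exact hrel r h
        · simp only [show ¬ (r + 1 ≤ r) by omega, le_refl, if_true, if_false]; exact hψ'rel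
      · rcases Nat.lt_succ_iff_lt_or_eq.mp (Nat.lt_succ_of_le hr) with h | rfl
        · simp only [show r ≤ s by omega, if_true]; exact hall r (by omega)
        · simp only [show ¬ (s + 1 ≤ s) by omega, if_false]; exact hψ'ker
  obtain ⟨Ψ, hΨ0, hrel, -, hall⟩ := step η' le_rfl
  refine ⟨Ψ, ?_, fun t => ?_, hrel, hall⟩
  · rw [hΨ0]; simp [ψ₀, hf]
  · rw [hΨ0]
    have : b (x (t + 1)) ∈ S := Submodule.mem_sup_left (Submodule.subset_span ⟨t, rfl⟩)
    exact hψ₀S this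

/-- Values of the cochain on the chain: `Ψ s (b x_t) = δ_{st}` (`s, t ≤ η'`). -/
theorem cochain_apply (hx : IsChain a b (η' + 1) x) {Ψ : ℕ → Dual k V} (h0 : Ψ 0 (b (x 0)) = 1)
    (h0' : ∀ t : Fin η', Ψ 0 (b (x (t + 1))) = 0) (hrel : ∀ r < η', Ψ (r + 1) ∘ₗ b = Ψ r ∘ₗ a) :
    ∀ s ≤ η', ∀ t ≤ η', Ψ s (b (x t)) = if s = t then 1 else 0 := by
  intro s
  induction s with
  | zero =>
    intro _ t ht
    cases t with
    | zero => simpa using h0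
    | succ t => simpa using h0' ⟨t, by omega⟩
  | succ s ih =>
    intro hs t ht
    have h := congrArg (fun g : Dual k U => g (x t)) (hrel s (by omega))
    simp only [LinearMap.coe_comp, Function.comp_apply] at h
    rw [h]
    cases t with
    | zero => rw [hx.head, map_zero]; simp
    | succ t => rw [hx.rel t, ih (by omega) t (by omega)]; simp

/-- **Peeling theorem** (`η ≥ 1`): a minimal nonzero chain of length `η' + 1` spans an `L_{η'+1}ᵀ` block that is a direct
summand: there are `a,b`-invariant complements `U'` of `⟨x₀,…,x_{η'+1}⟩` and `V'` of `⟨b x₀,…,b x_{η'}⟩`. -/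
theorem peel_succ (hx : IsChain a b (η' + 1) x) (hx0 : x ≠ 0) (hmin : MinimalAt a b (η' + 1)) :
    ∃ (U' : Submodule k U) (V' : Submodule k V), (∀ u ∈ U', a u ∈ V') ∧ (∀ u ∈ U', b u ∈ V') ∧
      IsCompl (span k (Set.range fun t : Fin (η' + 2) => x t)) U' ∧
      IsCompl (span k (Set.range fun t : Fin (η' + 1) => b (x t))) V' := by
  classical
  obtain ⟨Ψ, h0, h0', hrel, hker⟩ := exists_cochain hx hx0 hmin
  have hδ := cochain_apply hx h0 h0' hrel
  -- the functionals on U: φ s = Ψ s ∘ b (s ≤ η'), φ (η'+1) = Ψ η' ∘ a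
  let φ : ℕ → Dual k U := fun s => if s ≤ η' then Ψ s ∘ₗ b else Ψ η' ∘ₗ a
  have hφ : ∀ s ≤ η' + 1, ∀ t ≤ η' + 1, φ s (x t) = if s = t then 1 else 0 := by
    intro s hs t ht
    by_cases hs' : s ≤ η'
    · simp only [φ, hs', if_true, LinearMap.coe_comp, Function.comp_apply]
      rcases Nat.lt_or_ge t (η' + 1) with ht' | ht'
      · exact hδ s hs' t (by omega)
      · obtain rfl : t = η' + 1 := by omega
        rw [hx.b_last]; simp; omega
    · obtain rfl : s = η' + 1 := by omega
      simp only [φ, show ¬ (η' + 1 ≤ η') by omega, if_false, LinearMap.coe_comp, Function.comp_apply]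
      cases t with
      | zero => rw [hx.head]; simp
      | succ t => rw [hx.rel t, hδ η' le_rfl t (by omega)]; simp
  let U' : Submodule k U := ⨅ s : Fin (η' + 2), LinearMap.ker (φ s)
  let V' : Submodule k V := ⨅ s : Fin (η' + 1), LinearMap.ker (Ψ s)
  have hU' : ∀ u, u ∈ U' ↔ ∀ s : Fin (η' + 2), φ s u = 0 := fun u => by simp [U', Submodule.mem_iInf]
  have hV' : ∀ v, v ∈ V' ↔ ∀ s : Fin (η' + 1), Ψ s v = 0 := fun v => by simp [V', Submodule.mem_iInf]
  refine ⟨U', V', fun u hu => ?_, fun u hu => ?_, ?_, ?_⟩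
  · -- a-invariance
    rw [hV']; intro s
    rcases Nat.lt_or_ge (s : ℕ) η' with hs | hs
    · have h := congrArg (fun g : Dual k U => g u) (hrel s hs)
      simp only [LinearMap.coe_comp, Function.comp_apply] at h
      rw [← h]
      have := (hU' u).mp hu ⟨s + 1, by omega⟩
      simpa [φ, show (s : ℕ) + 1 ≤ η' from hs] using this
    · have hs' : (s : ℕ) = η' := by omega
      have := (hU' u).mp hu ⟨η' + 1, by omega⟩
      simp only [φ, show ¬ (η' + 1 ≤ η') by omega, if_false, LinearMap.coe_comp, Function.comp_apply] at this
      rw [show s = ⟨η', by omega⟩ from Fin.ext hs']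
      exact this
  · -- b-invariance
    rw [hV']; intro s
    have := (hU' u).mp hu ⟨s, by omega⟩
    simpa [φ, show (s : ℕ) ≤ η' by omega] using this
  · -- U = X ⊕ U'
    refine ⟨Submodule.disjoint_def.mpr fun u hu hu' => ?_, codisjoint_iff.mpr (Submodule.eq_top_iff'.mpr fun u => ?_)⟩
    · obtain ⟨d, rfl⟩ := (Submodule.mem_span_range_iff_exists_fun k).mp hu
      have hd : ∀ s : Fin (η' + 2), d s = 0 := fun s => by
        have h := (hU' _).mp hu' s
        rw [map_sum] at h
        simp only [map_smul, smul_eq_mul] at h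
        rw [Finset.sum_eq_single s] at h
        · simpa [hφ s (by omega) s (by omega)] using h
        · intro t _ hts
          rw [hφ s (by omega) t (by omega), if_neg (fun h => hts (Fin.ext h.symm)), mul_zero]
        · simp
      simp [hd]
    · have hdec : u = (∑ s : Fin (η' + 2), φ s u • x s) + (u - ∑ s : Fin (η' + 2), φ s u • x s) := by abel
      rw [hdec]
      refine Submodule.add_mem_sup (Submodule.sum_mem _ fun s _ => Submodule.smul_mem _ _ (subset_span ⟨s, rfl⟩))
        ((hU' _).mpr fun r => ?_)
      rw [map_sub, map_sum]
      simp only [map_smul, smul_eq_mul]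
      rw [Finset.sum_eq_single r]
      · rw [hφ r (by omega) r (by omega), if_pos rfl, mul_one, sub_self]
      · intro t _ htr
        rw [hφ r (by omega) t (by omega), if_neg (fun h => htr (Fin.ext h.symm)), mul_zero]
      · simp
  · -- V = W ⊕ V'
    refine ⟨Submodule.disjoint_def.mpr fun v hv hv' => ?_, codisjoint_iff.mpr (Submodule.eq_top_iff'.mpr fun v => ?_)⟩
    · obtain ⟨d, rfl⟩ := (Submodule.mem_span_range_iff_exists_fun k).mp hv
      have hd : ∀ s : Fin (η' + 1), d s = 0 := fun s => by
        have h := (hV' _).mp hv' s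
        rw [map_sum] at h
        simp only [map_smul, smul_eq_mul] at h
        rw [Finset.sum_eq_single s] at h
        · simpa [hδ s (by omega) s (by omega)] using h
        · intro t _ hts
          rw [hδ s (by omega) t (by omega), if_neg (fun h => hts (Fin.ext h.symm)), mul_zero]
        · simp
      simp [hd]
    · have hdec : v = (∑ s : Fin (η' + 1), Ψ s v • b (x s)) + (v - ∑ s : Fin (η' + 1), Ψ s v • b (x s)) := by abel
      rw [hdec]
      refine Submodule.add_mem_sup (Submodule.sum_mem _ fun s _ => Submodule.smul_mem _ _ (subset_span ⟨s, rfl⟩))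
        ((hV' _).mpr fun r => ?_)
      rw [map_sub, map_sum]
      simp only [map_smul, smul_eq_mul]
      rw [Finset.sum_eq_single r]
      · rw [hδ r (by omega) r (by omega), if_pos rfl, mul_one, sub_self]
      · intro t _ htr
        rw [hδ r (by omega) t (by omega), if_neg (fun h => htr (Fin.ext h.symm)), mul_zero]
      · simp

/-- **Peeling theorem, length `0`**: a nonzero chain of length `0` is a vector `x₀ ≠ 0` with `a x₀ = b x₀ = 0` (an `L₀ᵀ`
block); any complement of `⟨x₀⟩` together with `V' = V` splits it off. -/
theorem peel_zero (x : ℕ → U) :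
    ∃ (U' : Submodule k U) (V' : Submodule k V), (∀ u ∈ U', a u ∈ V') ∧ (∀ u ∈ U', b u ∈ V') ∧
      IsCompl (span k (Set.range fun t : Fin 1 => x t)) U' ∧
      IsCompl (span k (Set.range fun t : Fin 0 => b (x t))) V' := by
  obtain ⟨U', hU'⟩ := Submodule.exists_isCompl (span k (Set.range fun t : Fin 1 => x t))
  refine ⟨U', ⊤, fun _ _ => Submodule.mem_top, fun _ _ => Submodule.mem_top, hU', ?_⟩
  have : span k (Set.range fun t : Fin 0 => b (x t)) = ⊥ := by
    rw [Submodule.span_eq_bot]; rintro _ ⟨t, rfl⟩; exact t.elim0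
  rw [this]
  exact isCompl_bot_top

/-- **Peeling theorem** (all lengths): a minimal nonzero chain of length `η` spans an `L_ηᵀ` block that is a direct
summand of the Kronecker module. -/
theorem peel {η : ℕ} (hx : IsChain a b η x) (hx0 : x ≠ 0) (hmin : MinimalAt a b η) :
    ∃ (U' : Submodule k U) (V' : Submodule k V), (∀ u ∈ U', a u ∈ V') ∧ (∀ u ∈ U', b u ∈ V') ∧
      IsCompl (span k (Set.range fun t : Fin (η + 1) => x t)) U' ∧
      IsCompl (span k (Set.range fun t : Fin η => b (x t))) V' := by
  cases η with
  | zero => exact peel_zero x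
  | succ η' => exact peel_succ hx hx0 hmin

end Peel

end Summit.MatrixMultiplication.OmegaCensus.SmallFormats.Kronecker
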